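import Summits.HodgeConjecture.HodgeConjecture.Theorems.K2E1bArchPacketSignsDefs   -- ★ p855974 (leaf U8-0): the imports∕opens of unit U8 (★ `UnitaryGroupArchCharacter`, measure theory, `ContRepresentation.IsUnitary` …)
import Literature.NumberTheory.Automorphic.GKModules                                -- ★ `kFiniteVectors` (Harish-Chandra: `K`-finite vectors); brings ★ `RealMatrixGroups` (`RealMatrixGroup`, `maximalCompact`)
import HarnessLib

/-!
# K2 ∕ E1b tier 1 · unit U8b «ARCHIMEDEAN ANALYTIC SOCKETS» — THEOREMS-SIDE DEFS LEAF (U8b-0) of `Cruxes/H413/Lines/K2_E1b_GKCohomologyU21_U8b_ArchAnalytic.lean`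

Cell hodgecm-mathlib, Track B «K2-LIT», engine E1b; crux item h413 = stmt-HodgeConjecture-24833; line author K2E1b-plan (g2); leaf typed by K2E1b-p08 (g2)
(E1b STANDING QUEUE Q2, 2026-09-04T00:03:57Z ∕ STATUS #4 00:23:55Z).  K2-lead RULING R3 (d) «DEFS BEFORE SIGS IS HARD»: no `Theorems/` file may import a `Cruxes/…/Lines`
module, so every `def` that the tier-1 sockets `sig_K2E1bIrredUnitaryHasGKClass` ∕ `sig_K2E1bArchOpTraceExists` ∕ `sig_K2E1bArchOpTraceOfClass` ∕ `sig_K2E1bPseudoCoefficientDS`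
or a tier-2 prover names must live in a ★ leaf FIRST.  THIS FILE is that leaf for unit U8b: §0 of the line module (ED. 1, commit 5b8ed6c62c9a) VERBATIM — `IsTemperedRep` +
`isTemperedRep_iff`, `IsDiscreteSeriesRep` + `isDiscreteSeriesRep_iff` + `IsDiscreteSeriesRep.isUnitary` — same namespace `…Cruxes.H413.K2E1bGKCohomologyU21.U8`, docstrings as
they stand (definitional predicates carry their sources in plain parentheses, hence untagged), so that the line module's ED. 2 imports this leaf and drops its local copies with
statement bytes equal (drill of leaf #1 ★ p854739 and leaf U8-0 ★ p855974).
Definitions only (+ the `Iff.rfl` unfoldings and the projection `IsDiscreteSeriesRep.isUnitary`); no `sorry`, no axiom, no instance, no notation.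
Sources (audited by the line author): [GetzHahn2024] Def. 4.6 p. 91; [CowlingHaagerupHowe1988]; [Knapp1986] Ch. VIII–IX.

HONEST LABEL: HC_CM is proved only modulo the 7 printed citations (2 remaining named inputs: hLiu418 = stmt-HodgeConjecture-24832,
h413 = stmt-HodgeConjecture-24833) until rung 0 closes; this file asserts nothing (definitions only).
-/

set_option autoImplicit false
set_option linter.dupNamespace false

noncomputable section

open NumberField MeasureTheory CompactlySupported
open scoped Matrix MatrixGroups InnerProductSpace ENNReal

namespace Summit.HodgeConjecture.HodgeConjecture.Cruxes.H413.K2E1bGKCohomologyU21.U8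

open Literature.NumberTheory.Automorphic
open Literature.RepresentationTheory.KonnoKonno2007 Literature.RepresentationTheory.KonnoKonno2007.RealDualPair

/-! ## §0 The definitions of unit U8b (VERBATIM from the line module's §0): tempered and discrete-series Hilbert representations via matrix coefficients -/

section MatrixCoefficients

variable {A : Type*} [NormedCommRing A] [NormedAlgebra ℝ A] [NormedAlgebra ℚ A] [CompleteSpace A] [StarRing A]
  {N : Type*} [Fintype N] [DecidableEq N]

/-- **Tempered representation** (matrix-coefficient form; GetzHahn2024, Def. 4.6 p. 91; CowlingHaagerupHowe1988): every matrix coefficient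
`g ↦ ⟪v, ϖ(g) w⟫` with `K`-FINITE `v, w` (★ `kFiniteVectors`, `K = G.maximalCompact`) lies in `L^{2+ε}(G, ν)` for every `ε > 0`.  Stated for a
linear real group `G : RealMatrixGroup A N` and any measure `ν` on it (used with a Haar measure).
Not to be confused with the ALGEBRAIC ★ `Representation.IsTempered ρ μ` (`Literature/NumberTheory/Automorphic/MatrixCoefficients.lean`,
domination modulo the centre, `Representation ℂ G V`, p-adic lane): different currency (Hilbert `G →* (E →L[ℂ] E)` here), distinct name.
(GetzHahn2024, Def. 4.6 p. 91) (CowlingHaagerupHowe1988) (Knapp1986, Ch. VIII) — a definitional predicate of the engine line (hence untagged). -/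
def IsTemperedRep (G : RealMatrixGroup A N) [MeasurableSpace G.carrier] (ν : Measure G.carrier)
    {E : Type} [NormedAddCommGroup E] [InnerProductSpace ℂ E] [CompleteSpace E] (ϖ : ContRepresentation ℂ G.carrier E) : Prop :=
  ∀ v ∈ kFiniteVectors G ϖ, ∀ w ∈ kFiniteVectors G ϖ, ∀ ε : ℝ, 0 < ε →
    MemLp (fun g : G.carrier => ⟪v, ϖ g w⟫_ℂ) (ENNReal.ofReal (2 + ε)) ν

/-- Unfolding `IsTemperedRep`. (GetzHahn2024, Def. 4.6 p. 91) -/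
theorem isTemperedRep_iff (G : RealMatrixGroup A N) [MeasurableSpace G.carrier] (ν : Measure G.carrier)
    {E : Type} [NormedAddCommGroup E] [InnerProductSpace ℂ E] [CompleteSpace E] (ϖ : ContRepresentation ℂ G.carrier E) :
    IsTemperedRep G ν ϖ ↔ ∀ v ∈ kFiniteVectors G ϖ, ∀ w ∈ kFiniteVectors G ϖ, ∀ ε : ℝ, 0 < ε →
      MemLp (fun g : G.carrier => ⟪v, ϖ g w⟫_ℂ) (ENNReal.ofReal (2 + ε)) ν := Iff.rfl

/-- **Discrete-series (square-integrable) representation** (GetzHahn2024, Def. 4.6 p. 91; Knapp1986, Ch. IX): `ϖ` is unitary, strongly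
continuous and topologically irreducible, and EVERY matrix coefficient `g ↦ ⟪v, ϖ(g) w⟫` (all `v, w`, not only `K`-finite ones — for an
irreducible unitary representation one non-zero square-integrable coefficient forces all of them to be, so this is the printed notion, and it is
junk-free) lies in `L²(G, ν)`.
`U(2,1)` has COMPACT centre, so square-integrability on `G` itself (not modulo the centre) is the
printed notion there.  Not to be confused with the ALGEBRAIC ★ `Representation.IsDiscreteSeries ρ μ` (`MatrixCoefficients.lean`, p-adic lane).
(GetzHahn2024, Def. 4.6 p. 91) (Knapp1986, Ch. IX) — a definitional predicate of the engine line (hence untagged). -/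
def IsDiscreteSeriesRep (G : RealMatrixGroup A N) [MeasurableSpace G.carrier] (ν : Measure G.carrier)
    {E : Type} [NormedAddCommGroup E] [InnerProductSpace ℂ E] [CompleteSpace E] (ϖ : ContRepresentation ℂ G.carrier E) : Prop :=
  ϖ.IsUnitary ∧ ϖ.IsStronglyContinuous ∧ ϖ.IsTopIrreducible ∧
    ∀ v w : E, MemLp (fun g : G.carrier => ⟪v, ϖ g w⟫_ℂ) 2 ν

/-- Unfolding `IsDiscreteSeriesRep`. (GetzHahn2024, Def. 4.6 p. 91) -/
theorem isDiscreteSeriesRep_iff (G : RealMatrixGroup A N) [MeasurableSpace G.carrier] (ν : Measure G.carrier)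
    {E : Type} [NormedAddCommGroup E] [InnerProductSpace ℂ E] [CompleteSpace E] (ϖ : ContRepresentation ℂ G.carrier E) :
    IsDiscreteSeriesRep G ν ϖ ↔ ϖ.IsUnitary ∧ ϖ.IsStronglyContinuous ∧ ϖ.IsTopIrreducible ∧
      ∀ v w : E, MemLp (fun g : G.carrier => ⟪v, ϖ g w⟫_ℂ) 2 ν := Iff.rfl

/-- A discrete-series representation is unitary, strongly continuous and irreducible (projections). (GetzHahn2024, Def. 4.6 p. 91) -/
theorem IsDiscreteSeriesRep.isUnitary {G : RealMatrixGroup A N} [MeasurableSpace G.carrier] {ν : Measure G.carrier}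
    {E : Type} [NormedAddCommGroup E] [InnerProductSpace ℂ E] [CompleteSpace E] {ϖ : ContRepresentation ℂ G.carrier E}
    (h : IsDiscreteSeriesRep G ν ϖ) : ϖ.IsUnitary ∧ ϖ.IsStronglyContinuous ∧ ϖ.IsTopIrreducible := ⟨h.1, h.2.1, h.2.2.1⟩

end MatrixCoefficients

end Summit.HodgeConjecture.HodgeConjecture.Cruxes.H413.K2E1bGKCohomologyU21.U8

end
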